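import Summits.HodgeConjecture.HodgeConjecture.Theorems.MarkmanPartnerTransportPicardThreeK3SquaresKugaSatakeSimilitude
import Summits.HodgeConjecture.HodgeConjecture.Theorems.MarkmanPartnerTransportPicardThreeK3SquaresOneAlgebraicClass

/-!
# Route MarkmanPartnerTransport · crux `PicardThreeK3Squares` (stmt-HodgeConjecture-19652) —
# sums of cycle-induced endomorphisms; HC⁴(S × S) for `E(S)` generated by TWO self-similitudes
# (the BIQUADRATIC real-multiplication cells `ρ(S) ∈ {6, 10}`), granted Kuga–Satake for `S`

`…KugaSatakeSimilitude` (this seat, gen 9) makes every rational Hodge SELF-SIMILITUDE `ψ` of `T(S)` (cup-self-adjoint,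
`ψ² = d ≠ 0` on `T(S)`, killing `N¹(S)`) cycle-induced, granted the Kuga–Satake statement for `S` and modulo
Varesco's Thm. 5.3, and concludes HC⁴(S × S) when ONE such `ψ` generates `E(S) = End_Hdg T(S)` (real-quadratic
`E`). When `E(S)` is a BIQUADRATIC totally real field `ℚ(√a, √b)` (possible at `ρ(S) = 6`, `l = 4`, and
`ρ(S) = 10`, `l = 3`: `[E:ℚ] · l = 22 − ρ`), it is generated by the SUM `√a + √b` of two self-similitudes, each
cycle-induced; so:

* `isCycleInducedTranscendentalEndomorphism_add` — cycle-induced transcendental endomorphisms are closed under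
  addition (`[γ₁]_* + [γ₂]_* = [γ₁ + γ₂]_*`; unconditional).
* `hodgeConjectureFor_square_of_two_selfSimilitudes_of_kugaSatake` — for a marked projective K3 surface `S`
  with algebraic Kuga–Satake correspondence and two self-similitudes `ψ₁`, `ψ₂` as above whose SUM generates
  `End_Hdg T(S)` (`TranscendentalEndomorphismsGeneratedBy S (ψ₁ + ψ₂)`): **`HodgeConjectureFor 4 (S ⊗ S)`**,
  by F4 with the cycle-induced generator `ψ₁ + ψ₂`. Covers `E(S)` biquadratic (and, with `ψ₂ = 0` excluded by
  `d₂ ≠ 0`, is used only for genuinely two-generated fields; the one-similitude case is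
  `hodgeConjectureFor_square_of_selfSimilitude_generator_of_kugaSatake`).

So, modulo Kuga–Satake, the crux's open core at `ρ(S) ∈ {6, 10}` shrinks further to `E(S)` quartic NOT
biquadratic (cyclic or non-Galois quartic) or cubic (`ρ = 10`). CONDITIONAL on `IsKSCorrespondenceAlgebraicBetti`
(open in print) and `Varesco2023_transcendentalHodgeSimilitude_algebraic_of_kugaSatake_K3`; no definition, no
sorry, no new named fact; nothing here proves HC. Prover seat hodge-nonav-19652-p1 (gen 9),
`--supports stmt-HodgeConjecture-19652`.

References: M. Varesco, Math. Z. 305 (2023) Thm. 5.3, Conj. 4.2; van Geemen–Schütt, Forum Math. Sigma 13 (2025)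
e2, §2.1, §4.8; E. Bayer-Fluckiger, B. van Geemen, M. Schütt, arXiv:2401.04072, Thm. A (existence of RM by any
totally real field); W. Fulton, *Intersection theory*, §16.1.
-/

set_option linter.dupNamespace false

noncomputable section

namespace Summit.HodgeConjecture.HodgeConjecture.Theorems.MarkmanPartnerTransport.KugaSatakeSimilitude

open Module CategoryTheory MonoidalCategory CartesianMonoidalCategory
open Literature.AlgebraicGeometry Literature.AlgebraicGeometry.Motives Literature.AlgebraicGeometry.HodgeTheory
open Literature.AlgebraicGeometry.Hyperkaehler Literature.AlgebraicGeometry.Surfaces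
open Literature.AlgebraicTopology.SingularHomology
open Summit.HodgeConjecture.HodgeConjecture.Theorems
open Summit.HodgeConjecture.HodgeConjecture.Theorems.MarkmanPartnerTransport

variable {S : SchemeOver ℂ} {η : complexBetti S (2 * 1) ≃ₗ[ℂ] (K3Index → ℂ)} {p : complexBetti S (2 * 2)}
  {x : K3Index → ℂ}

/-- `MarkedK3[S, η, p, x]`: VERBATIM the `let MarkedK3 := …` binder of the route declaration
`PicardThreeK3Squares`. Local notation only. -/
local notation3 (prettyPrint := false) "MarkedK3[" S ", " η ", " p ", " x "]" =>
  (p ≠ 0 ∧ (IsIntegralClass p ∧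
    (∀ q : complexBetti S (2 * 2), IsIntegralClass q → ∃ n : ℤ, q = n • p) ∧
    (∀ c : complexBetti S (2 * 1), IsIntegralClass c ↔ ∃ v : K3Index → ℤ, η c = fun i => (v i : ℂ)) ∧
    (∀ a b : complexBetti S (2 * 1),
      cupProduct (rfl : 2 * 1 + 2 * 1 = 2 * 2) a b = k3Form (η a) (η b) • p) ∧
    IsOfHodgeType 2 S (2 * 1) 2 0 (LinearEquiv.symm η x) ∧
    (∀ τ : complexBetti S (2 * 1), IsOfHodgeType 2 S (2 * 1) 2 0 τ →
      ∃ t : ℂ, τ = t • LinearEquiv.symm η x)) ∧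
    (k3Form x x = 0 ∧ 0 < (k3Form (star x) x).re ∧
      ∃ u : K3Index → ℤ, k3Form (fun i => (u i : ℂ)) x = 0 ∧ 0 < ∑ i, ∑ j, u i * k3Gram i j * u j))

/-- `Corr[μ, hS ; γ, y] = fst_*(snd^* y ∪ γ)` on `H²(S(ℂ); ℂ)`. Local notation only. -/
local notation3 (prettyPrint := false) "Corr[" μ ", " hS " ; " γ ", " y "]" =>
  complexGysin μ (IsSmoothProjective.tensor_holds hS hS) hS
    (SemiCartesianMonoidalCategory.fst _ _) (rfl : 2 * 1 + 2 * 2 + 2 * 2 = 2 * 1 + 2 * (2 + 2))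
    (cupProduct (rfl : 2 * 1 + 2 * 2 = 2 * 1 + 2 * 2)
      (complexBetti.map (SemiCartesianMonoidalCategory.snd _ _) (2 * 1) y) γ)

/-- `Transc[S, y]`: `y` is cup-orthogonal to `N¹(S)`. Local notation only. -/
local notation3 (prettyPrint := false) "Transc[" S ", " y "]" =>
  (∀ d ∈ algebraicClasses S 1, cupProduct (rfl : 2 * 1 + 2 * 1 = 2 * 2) y d = 0)

/-! ### Sums of cycle-induced endomorphisms -/

/-- **Cycle-induced transcendental endomorphisms are closed under addition**: `[γ₁]_* + [γ₂]_* = [γ₁ + γ₂]_*`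
(the correspondence action is linear in the class), sums of rational / type-`(i,j)` / `N¹`-orthogonal classes
stay such. Unconditional. [cite: Fulton1998, §16.1 Prop. 16.1.1] [cite: VoisinHodgeI2002, §11.1.2 Prop. 11.20] -/
theorem isCycleInducedTranscendentalEndomorphism_add (hS : IsK3Surface S)
    {t₁ t₂ : complexBetti S (2 * 1) →ₗ[ℂ] complexBetti S (2 * 1)}
    (h₁ : IsCycleInducedTranscendentalEndomorphism S hS.isSmoothProjective t₁)
    (h₂ : IsCycleInducedTranscendentalEndomorphism S hS.isSmoothProjective t₂) :
    IsCycleInducedTranscendentalEndomorphism S hS.isSmoothProjective (t₁ + t₂) := by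
  obtain ⟨h1rat, h1typ, h1N, h1perp, γ₁, hγ₁, hγ₁t⟩ := h₁
  obtain ⟨h2rat, h2typ, h2N, h2perp, γ₂, hγ₂, hγ₂t⟩ := h₂
  refine ⟨fun y hy => ?_, fun i j y hy => ?_, fun d hd => ?_, fun y d hd => ?_,
    γ₁ + γ₂, Submodule.add_mem _ hγ₁ hγ₂, fun y => ?_⟩
  · rw [LinearMap.add_apply]
    exact (h1rat y hy).add (h2rat y hy)
  · rw [LinearMap.add_apply]
    exact (h1typ i j y hy).add hS.isSmoothProjective (h2typ i j y hy)
  · rw [LinearMap.add_apply, h1N d hd, h2N d hd, add_zero]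
  · rw [LinearMap.add_apply, LinearMap.map_add₂, h1perp y d hd, h2perp y d hd, add_zero]
  · rw [LinearMap.add_apply, hγ₁t y, hγ₂t y, OneCycle.corr_eq_corrAction, OneCycle.corr_eq_corrAction,
      OneCycle.corr_eq_corrAction, map_add, LinearMap.add_apply]

/-! ### HC⁴(S × S) for `E(S)` generated by two self-similitudes, granted Kuga–Satake -/

/-- **HC⁴(S × S) when `End_Hdg T(S)` is generated by the sum of TWO rational Hodge self-similitudes, granted
Kuga–Satake for `S`** (the biquadratic cells). Data: a marked projective K3 surface `(S, η, p, x)` with algebraic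
Kuga–Satake correspondence (`IsKSCorrespondenceAlgebraicBetti`, hypothesis), and `ψ₁`, `ψ₂ ∈ End H²(S(ℂ); ℂ)`
each rational, type-preserving, killing `N¹(S)`, with image cup-orthogonal to `N¹(S)`, cup-self-adjoint, with
`ψᵢ² = dᵢ ≠ 0` on `T(S)`; if `ψ₁ + ψ₂` GENERATES (`TranscendentalEndomorphismsGeneratedBy S (ψ₁ + ψ₂)`, e.g.
`E(S) = ℚ(√a, √b) = ℚ(√a + √b)`), then `HodgeConjectureFor 4 (S ⊗ S)`: each `ψᵢ` is cycle-induced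
(`isCycleInduced_of_selfSimilitude_of_kugaSatake`), so is the sum, and F4 concludes. CONDITIONAL (Kuga–Satake
hypothesis; fact Varesco2023); credits nothing to HC. [cite: Varesco2023, Thm. 5.3 and Conj. 4.2]
[cite: GeemenSchutt2023, §2.1 and §4.8] -/
theorem hodgeConjectureFor_square_of_two_selfSimilitudes_of_kugaSatake
    (hVar : Varesco2023_transcendentalHodgeSimilitude_algebraic_of_kugaSatake_K3)
    (hS : IsK3Surface S) (hM : MarkedK3[S, η, p, x])
    (hKS : IsKSCorrespondenceAlgebraicBetti hS.isSmoothProjective)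
    (ψ₁ ψ₂ : complexBetti S (2 * 1) →ₗ[ℂ] complexBetti S (2 * 1))
    (h1₁ : ∀ y, IsRationalClass y → IsRationalClass (ψ₁ y))
    (h2₁ : ∀ (i j : ℕ) y, IsOfHodgeType 2 S (2 * 1) i j y → IsOfHodgeType 2 S (2 * 1) i j (ψ₁ y))
    (h3₁ : ∀ d ∈ algebraicClasses S 1, ψ₁ d = 0)
    (h4₁ : ∀ y : complexBetti S (2 * 1), Transc[S, ψ₁ y])
    (h5₁ : ∀ y w : complexBetti S (2 * 1),
      cupProduct (rfl : 2 * 1 + 2 * 1 = 2 * 2) (ψ₁ y) w = cupProduct (rfl : 2 * 1 + 2 * 1 = 2 * 2) y (ψ₁ w))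
    (d₁ : ℚ) (hd₁ : d₁ ≠ 0) (hψψ₁ : ∀ y : complexBetti S (2 * 1), Transc[S, y] → ψ₁ (ψ₁ y) = (d₁ : ℂ) • y)
    (h1₂ : ∀ y, IsRationalClass y → IsRationalClass (ψ₂ y))
    (h2₂ : ∀ (i j : ℕ) y, IsOfHodgeType 2 S (2 * 1) i j y → IsOfHodgeType 2 S (2 * 1) i j (ψ₂ y))
    (h3₂ : ∀ d ∈ algebraicClasses S 1, ψ₂ d = 0)
    (h4₂ : ∀ y : complexBetti S (2 * 1), Transc[S, ψ₂ y])
    (h5₂ : ∀ y w : complexBetti S (2 * 1),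
      cupProduct (rfl : 2 * 1 + 2 * 1 = 2 * 2) (ψ₂ y) w = cupProduct (rfl : 2 * 1 + 2 * 1 = 2 * 2) y (ψ₂ w))
    (d₂ : ℚ) (hd₂ : d₂ ≠ 0) (hψψ₂ : ∀ y : complexBetti S (2 * 1), Transc[S, y] → ψ₂ (ψ₂ y) = (d₂ : ℂ) • y)
    (hgen : TranscendentalEndomorphismsGeneratedBy S (ψ₁ + ψ₂)) :
    HodgeConjectureFor 4 (S ⊗ S) :=
  SquareOfGenerator.hodgeConjectureFor_tensor_self_of_generated hS (ψ₁ + ψ₂)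
    (isCycleInducedTranscendentalEndomorphism_add hS
      (isCycleInduced_of_selfSimilitude_of_kugaSatake hVar hS hM hKS ψ₁ h1₁ h2₁ h3₁ h4₁ h5₁ d₁ hd₁ hψψ₁)
      (isCycleInduced_of_selfSimilitude_of_kugaSatake hVar hS hM hKS ψ₂ h1₂ h2₂ h3₂ h4₂ h5₂ d₂ hd₂ hψψ₂))
    hgen

end Summit.HodgeConjecture.HodgeConjecture.Theorems.MarkmanPartnerTransport.KugaSatakeSimilitude

end
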